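import Literature.IUT.LogThetaLattice.DHodgeTheaterGroupoid
import Literature.IUT.HodgeTheaters.ThetaPMEllHodgeTheaters

/-!
# The representative-level groupoid of `Θ^{±ell}`-Hodge theaters over the `𝒟`-level one ([IUTchI] Def 6.11 (iii), Cor 6.12 (i); [IUTchIII] Prop 1.3 (i))

Mochizuki, *Inter-universal Teichmüller Theory I*, kurims manuscript (May 2020), §6, Def 6.11 (iii) p. 173
("an isomorphism of Θ^{±ell}-Hodge theaters is … a pair of morphisms between the respective associated Θ^±- and
Θ^{ell}-bridges that are compatible … in the sense that they induce the same poly-isomorphism between the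
respective capsules of `ℱ`-prime-strips"; Def 6.11 (i): such morphisms are pairs of poly-isomorphisms of
`ℱ`-prime-strips "that lift" a morphism of the associated `𝒟`-bridges), Cor 6.12 (i) p. 173 ("the natural
functorially induced map from the set of isomorphisms between two … Θ^{±ell}-Hodge theaters to the set of
isomorphisms between the respective associated … `𝒟-Θ^{±ell}`-Hodge theaters is bijective"; proof: Cor 5.3 (ii));
*III* (May 2020), Prop 1.3 (i) p. 42 (`†𝔉_≻` "one of the `ℱ`-prime-strips that appear in the Θ- and Θ^±-bridges";
the log-link is built from a SINGLE `Ξ`, Rmk 1.3.1 p. 43).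
([IUTchI] Def 6.11 (iii) p.173) [claim: Mochizuki2012, status: disputed]. MERGE BRIDGE (plan/L6/MERGE-MAP.md §8 B10
part 2, `StripFrame.ofKits`, HT half, `ℱ`-level), consumer seat abc-iut-L6-t3 over abc-iut-L5-t4's
`ThetaPMEllHodgeTheaters.lean` (`FKit.ThetaPMEllHT`, `.dHT` — nothing else of that file is used) and this seat's
`DHodgeTheaterGroupoid.lean`. Nothing of the series is asserted.

* `HTRep.FRepIso H₁ H₂` — a representative `toD : DRepIso †HT^𝒟 ‡HT^𝒟` of an isomorphism of the associated
  `𝒟-Θ^{±ell}`-Hodge theaters together with SINGLE isomorphisms of `ℱ`-prime-strips `†𝔉_t ⥲ ‡𝔉_{ι t}`,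
  `†𝔉_≻ ⥲ ‡𝔉_≻` LIFTING its constituents (fields `caps_lifts`, `cod_lifts`: "that lifts", Def 6.11 (i)) — the same
  shape (`toD` + `ℱ`-level data + lifting equations) as abc-iut-L5-t4/L5-t5's poly-level `IsoF`;
* `HTRep FK` — the `Θ^{±ell}`-Hodge theaters as a GROUPOID with these morphisms; `toDFunctor : HTRep FK ⥤ DHTRep K`
  ("associated `𝒟-Θ^{±ell}`-Hodge theater", functorial) and `codFunctor : HTRep FK ⥤ FK.FStrip` (`†ℋ𝒯 ↦ †𝔉_≻`, the
  `StripFrame.strip ≻` shape) with the commuting isomorphism `strip_comm` (`𝒟(†𝔉_≻) = †𝔇_≻` compatibly — the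
  `StripFrame.strip_comm` shape);
* Cor 6.12 (i) at the representative level: under Cor 5.3 (ii) (`FKit.IsomFtoDBijective`, abc-iut-L5-t4's named
  statement, taken as a hypothesis) `FRepIso.toD` is a BIJECTION `FRepIso H₁ H₂ ≃ DRepIso †HT^𝒟 ‡HT^𝒟`
  (`FRepIso.equivOfBijective`) — i.e. `toDFunctor` is full and faithful.
-/

noncomputable section

namespace Literature.IUT.LogThetaLattice

open CategoryTheory
open Literature.IUT.HodgeTheaters Literature.IUT.HodgeTheaters.PMBaseKit

universe u

variable {l : ℕ} {K : PMBaseKit.{u} l} {M : K.MultKit} {FK : K.FKit M}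

namespace HTRep

open DHTRep

/-! ### Transport of `ℱ`-capsule members along equalities of indices -/

/-- **IUTchI:Def6.11(iii)** (kurims p.173) Transport of the constituent `†𝔉_t` of the capsule `†𝔉_T` along `t = t'` (identity,
re-typed). ([IUTchI] Def 6.11 (iii) p.173) [claim: Mochizuki2012, status: disputed] -/
def capsCastF (H : FK.ThetaPMEllHT) {t t' : H.T} (h : t = t') : (H.capsule t).Iso (H.capsule t') :=
  fun v => eqToIso (congrArg (fun s => (H.capsule s).obj v) h)

/-- **IUTchI:Def6.11(iii)** (kurims p.173) The `𝒟`-prime-strip isomorphism associated to the `ℱ`-level transport is the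
`𝒟`-level transport. ([IUTchI] Rmk 5.2.1 (i) p.143) [claim: Mochizuki2012, status: disputed] -/
theorem assocDMap_capsCastF (H : FK.ThetaPMEllHT) {t t' : H.T} (h : t = t') :
    FKit.FStrip.assocDMap (capsCastF H h) = capsCast H.dHT h := by
  subst h
  funext v
  exact (FK.toD v).mapIso_refl _

/-! ### Representative-level isomorphisms of `Θ^{±ell}`-Hodge theaters -/

/-- **IUTchI:Def6.11(iii)** (kurims p.173) A **representative of an isomorphism of `Θ^{±ell}`-Hodge theaters** `†ℋ𝒯^{Θ±ell} ⥲ ‡ℋ𝒯^{Θ±ell}`: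
a representative `toD` of an isomorphism of the associated `𝒟-Θ^{±ell}`-Hodge theaters (Def 6.4 (iii)) together with single
isomorphisms of `ℱ`-prime-strips `†𝔉_t ⥲ ‡𝔉_{ι t}` (`t ∈ T`) and `†𝔉_≻ ⥲ ‡𝔉_≻` LIFTING its capsule and codomain constituents
("poly-isomorphisms … that lift a morphism between the associated `𝒟-Θ^±`-bridges", Def 6.11 (i); for the `Θ^{ell}`-bridge the
`ℱ`-datum is the capsule part only, Def 6.11 (ii) — so "induce the same poly-isomorphism between the respective capsules"
holds by construction). ([IUTchI] Def 6.11 (iii) p.173) [claim: Mochizuki2012, status: disputed] -/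
@[ext]
structure FRepIso (H₁ H₂ : FK.ThetaPMEllHT) : Type u where
  /-- the representative of the isomorphism of associated `𝒟-Θ^{±ell}`-Hodge theaters -/
  toD : DRepIso H₁.dHT H₂.dHT
  /-- `†𝔉_t ⥲ ‡𝔉_{ι t}` -/
  caps : ∀ t, (H₁.capsule t).Iso (H₂.capsule (toD.ι t))
  /-- `†𝔉_≻ ⥲ ‡𝔉_≻` -/
  cod : H₁.codomain.Iso H₂.codomain
  /-- `caps t` lifts the `𝒟`-constituent `†𝔇_t ⥲ ‡𝔇_{ι t}` of `toD` -/
  caps_lifts : ∀ t, FKit.FStrip.assocDMap (caps t) = toD.caps t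
  /-- `cod` lifts the `𝒟`-constituent `†𝔇_≻ ⥲ ‡𝔇_≻` of `toD` -/
  cod_lifts : FKit.FStrip.assocDMap cod = toD.cod

namespace FRepIso

variable {H₁ H₂ H₃ : FK.ThetaPMEllHT}

/-- **IUTchI:Def6.11(iii)** (kurims p.173) The identity representative. ([IUTchI] Def 6.11 (iii) p.173) [claim: Mochizuki2012, status: disputed] -/
def refl (H : FK.ThetaPMEllHT) : FRepIso H H where
  toD := DRepIso.refl H.dHT
  caps _ := fun _ => Iso.refl _
  cod := fun _ => Iso.refl _
  caps_lifts _ := funext fun v => (FK.toD v).mapIso_refl _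
  cod_lifts := funext fun v => (FK.toD v).mapIso_refl _

/-- **IUTchI:Def6.11(i)** (kurims p.172) Composition of representatives (composite `𝒟`-level representative, composite lifts).
([IUTchI] Def 6.11 (i) p.172) [claim: Mochizuki2012, status: disputed] -/
def trans (f : FRepIso H₁ H₂) (g : FRepIso H₂ H₃) : FRepIso H₁ H₃ where
  toD := f.toD.trans g.toD
  caps t := fun v => f.caps t v ≪≫ g.caps (f.toD.ι t) v
  cod := fun v => f.cod v ≪≫ g.cod v
  caps_lifts t := by
    funext v
    show (FK.toD v).mapIso (f.caps t v ≪≫ g.caps (f.toD.ι t) v) = (f.toD.caps t).trans (g.toD.caps (f.toD.ι t)) v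
    rw [Functor.mapIso_trans, ← f.caps_lifts, ← g.caps_lifts]
    rfl
  cod_lifts := by
    funext v
    show (FK.toD v).mapIso (f.cod v ≪≫ g.cod v) = (f.toD.cod.trans g.toD.cod) v
    rw [Functor.mapIso_trans, ← f.cod_lifts, ← g.cod_lifts]
    rfl

/-- **IUTchI:Def6.11(iii)** (kurims p.173) The inverse representative (inverse `𝒟`-level representative; inverse lifts, the capsule one
re-typed along `ι(ι⁻¹ t') = t'`). ([IUTchI] Def 6.11 (iii) p.173) [claim: Mochizuki2012, status: disputed] -/
def symm (f : FRepIso H₁ H₂) : FRepIso H₂ H₁ where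
  toD := f.toD.symm
  caps t' := fun v => capsCastF H₂ (f.toD.ι.apply_symm_apply t').symm v ≪≫ (f.caps (f.toD.ι.symm t') v).symm
  cod := fun v => (f.cod v).symm
  caps_lifts t' := by
    funext v
    show (FK.toD v).mapIso (capsCastF H₂ _ v ≪≫ (f.caps (f.toD.ι.symm t') v).symm) =
      capsCast H₂.dHT _ v ≪≫ (f.toD.caps (f.toD.ι.symm t') v).symm
    rw [Functor.mapIso_trans, Functor.mapIso_symm, ← f.caps_lifts, ← assocDMap_capsCastF]
    rfl
  cod_lifts := by
    funext v
    show (FK.toD v).mapIso ((f.cod v).symm) = (f.toD.cod v).symm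
    rw [Functor.mapIso_symm, ← f.cod_lifts]
    rfl

/-- **IUTchI:Def6.11(iii)** (kurims p.173) Extensionality for representatives: equal `𝒟`-representatives, and `ℱ`-level data that
agree after the evident re-typing. ([IUTchI] Def 6.11 (iii) p.173) [claim: Mochizuki2012, status: disputed] -/
theorem ext_of_caps {f g : FRepIso H₁ H₂} (hD : f.toD = g.toD)
    (hcaps : ∀ t v, (f.caps t v).hom ≫ eqToHom (by rw [hD]) = (g.caps t v).hom) (hcod : f.cod = g.cod) :
    f = g := by
  obtain ⟨d, caps, cod, _, _⟩ := f
  obtain ⟨d', caps', cod', _, _⟩ := g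
  cases hD
  cases hcod
  simp only [eqToHom_refl, Category.comp_id] at hcaps
  obtain rfl : caps = caps' := funext fun t => funext fun v => Iso.ext (hcaps t v)
  rfl

/-- **IUTchI:Def6.11(i)** (kurims p.172) Left identity. ([IUTchI] Def 6.11 (i) p.172) [claim: Mochizuki2012, status: disputed] -/
theorem refl_trans (f : FRepIso H₁ H₂) : (refl H₁).trans f = f :=
  FRepIso.ext (DRepIso.refl_trans _) (heq_of_eq (funext fun _ => funext fun _ => Iso.refl_trans _))
    (funext fun _ => Iso.refl_trans _)

/-- **IUTchI:Def6.11(i)** (kurims p.172) Right identity. ([IUTchI] Def 6.11 (i) p.172) [claim: Mochizuki2012, status: disputed] -/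
theorem trans_refl (f : FRepIso H₁ H₂) : f.trans (refl H₂) = f :=
  FRepIso.ext (DRepIso.trans_refl _) (heq_of_eq (funext fun _ => funext fun _ => Iso.trans_refl _))
    (funext fun _ => Iso.trans_refl _)

/-- **IUTchI:Def6.11(i)** (kurims p.172) Associativity. ([IUTchI] Def 6.11 (i) p.172) [claim: Mochizuki2012, status: disputed] -/
theorem trans_assoc {H₄ : FK.ThetaPMEllHT} (f : FRepIso H₁ H₂) (g : FRepIso H₂ H₃) (h : FRepIso H₃ H₄) :
    (f.trans g).trans h = f.trans (g.trans h) :=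
  FRepIso.ext (DRepIso.trans_assoc _ _ _) (heq_of_eq (funext fun _ => funext fun _ => Iso.trans_assoc _ _ _))
    (funext fun _ => Iso.trans_assoc _ _ _)

/-- **IUTchI:Def6.11(iii)** (kurims p.173) The inverse representative is a left inverse. ([IUTchI] Def 6.11 (iii) p.173) [claim: Mochizuki2012, status: disputed] -/
theorem symm_trans (f : FRepIso H₁ H₂) : f.symm.trans f = refl H₂ := by
  refine ext_of_caps (DRepIso.symm_trans f.toD) (fun t' v => ?_) (funext fun v => Iso.symm_self_id _)
  show ((capsCastF H₂ (f.toD.ι.apply_symm_apply t').symm v ≪≫ (f.caps (f.toD.ι.symm t') v).symm) ≪≫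
      f.caps (f.toD.ι.symm t') v).hom ≫ eqToHom _ = (Iso.refl ((H₂.capsule t').obj v)).hom
  simp [capsCastF]

/-- **IUTchI:Def6.11(iii)** (kurims p.173) The inverse representative is a right inverse (formally from the left-inverse law for `f`
and for `f.symm`). ([IUTchI] Def 6.11 (iii) p.173) [claim: Mochizuki2012, status: disputed] -/
theorem trans_symm (f : FRepIso H₁ H₂) : f.trans f.symm = refl H₁ := by
  have h2 : f.symm.symm = f := by
    calc f.symm.symm = f.symm.symm.trans (refl H₂) := (trans_refl _).symm
      _ = f.symm.symm.trans (f.symm.trans f) := by rw [symm_trans]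
      _ = (f.symm.symm.trans f.symm).trans f := (trans_assoc _ _ _).symm
      _ = (refl H₁).trans f := by rw [symm_trans]
      _ = f := refl_trans f
  nth_rewrite 1 [← h2]
  exact symm_trans f.symm

/-! ### Cor 6.12 (i) at the representative level -/

/-- **IUTchI:Cor5.3(ii)** (kurims p.144) Under Cor 5.3 (ii) (`FKit.IsomFtoDBijective`, abc-iut-L5-t4's named statement) an
isomorphism of associated `𝒟`-prime-strips lifts to a unique isomorphism of `ℱ`-prime-strips. ([IUTchI] Cor 5.3 (ii) p.144) [claim: Mochizuki2012, status: disputed] -/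
noncomputable def liftIso (h : FK.IsomFtoDBijective) {F₁ F₂ : FK.FStrip} (ψ : F₁.assocD.Iso F₂.assocD) :
    F₁.Iso F₂ :=
  (Equiv.ofBijective _ (h F₁ F₂)).symm ψ

/-- **IUTchI:Cor5.3(ii)** (kurims p.144) The lift maps to the given isomorphism. ([IUTchI] Cor 5.3 (ii) p.144) [claim: Mochizuki2012, status: disputed] -/
@[simp] theorem assocDMap_liftIso (h : FK.IsomFtoDBijective) {F₁ F₂ : FK.FStrip} (ψ : F₁.assocD.Iso F₂.assocD) :
    FKit.FStrip.assocDMap (liftIso h ψ) = ψ :=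
  (Equiv.ofBijective _ (h F₁ F₂)).apply_symm_apply ψ

/-- **IUTchI:Cor5.3(ii)** (kurims p.144) Uniqueness of lifts. ([IUTchI] Cor 5.3 (ii) p.144) [claim: Mochizuki2012, status: disputed] -/
@[simp] theorem liftIso_assocDMap (h : FK.IsomFtoDBijective) {F₁ F₂ : FK.FStrip} (φ : F₁.Iso F₂) :
    liftIso h (FKit.FStrip.assocDMap φ) = φ :=
  (Equiv.ofBijective _ (h F₁ F₂)).symm_apply_apply φ

/-- **IUTchI:Cor6.12(i)** (kurims p.173) The representative with prescribed `𝒟`-level representative, under Cor 5.3 (ii): lift every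
constituent. ([IUTchI] Cor 6.12 (i) p.173) [claim: Mochizuki2012, status: disputed] -/
noncomputable def ofD (h : FK.IsomFtoDBijective) (d : DRepIso H₁.dHT H₂.dHT) : FRepIso H₁ H₂ where
  toD := d
  caps t := liftIso h (d.caps t)
  cod := liftIso h d.cod
  caps_lifts _ := assocDMap_liftIso h _
  cod_lifts := assocDMap_liftIso h _

/-- **IUTchI:Cor6.12(i)** (kurims p.173) **Cor 6.12 (i) at the representative level**: "the natural functorially induced map from
the set of isomorphisms between two … Θ^{±ell}-Hodge theaters to the set of isomorphisms between the respective associated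
… `𝒟-Θ^{±ell}`-Hodge theaters is bijective" — here for representatives, GIVEN Cor 5.3 (ii) as the hypothesis
`FKit.IsomFtoDBijective` (its printed proof: "follows immediately from Definition 6.11; Corollary 5.3, (ii)").
([IUTchI] Cor 6.12 (i) p.173) [claim: Mochizuki2012, status: disputed] -/
noncomputable def equivOfBijective (h : FK.IsomFtoDBijective) : FRepIso H₁ H₂ ≃ DRepIso H₁.dHT H₂.dHT where
  toFun := toD
  invFun := ofD h
  left_inv f := by
    refine FRepIso.ext rfl (heq_of_eq (funext fun t => ?_)) ?_
    · show liftIso h (f.toD.caps t) = f.caps t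
      rw [← f.caps_lifts, liftIso_assocDMap]
    · show liftIso h f.toD.cod = f.cod
      rw [← f.cod_lifts, liftIso_assocDMap]
  right_inv _ := rfl

/-- **IUTchI:Cor6.12(i)** (kurims p.173) Hence `toD` is a bijection on representatives (Cor 6.12 (i), representative level, given
Cor 5.3 (ii)). ([IUTchI] Cor 6.12 (i) p.173) [claim: Mochizuki2012, status: disputed] -/
theorem toD_bijective (h : FK.IsomFtoDBijective) :
    Function.Bijective (toD : FRepIso H₁ H₂ → DRepIso H₁.dHT H₂.dHT) :=
  (equivOfBijective h).bijective

end FRepIso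

end HTRep

/-- **IUTchI:Def6.11(iii)** (kurims p.173) The `Θ^{±ell}`-Hodge theaters over the kit `FK` as the objects of the representative-level
groupoid (a type synonym of abc-iut-L5-t4's `FKit.ThetaPMEllHT`). ([IUTchI] Def 6.11 (iii) p.173) [claim: Mochizuki2012, status: disputed] -/
def HTRep (FK : K.FKit M) : Type (max 1 u) := FK.ThetaPMEllHT

namespace HTRep

/-- **IUTchI:Def6.11(iii)** (kurims p.173) A `Θ^{±ell}`-Hodge theater as an object of `HTRep FK`. ([IUTchI] Def 6.11 (iii) p.173) [claim: Mochizuki2012, status: disputed] -/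
def of (H : FK.ThetaPMEllHT) : HTRep FK := H

/-- **IUTchI:Def6.11(iii)** (kurims p.173) The underlying `Θ^{±ell}`-Hodge theater. ([IUTchI] Def 6.11 (iii) p.173) [claim: Mochizuki2012, status: disputed] -/
def out (X : HTRep FK) : FK.ThetaPMEllHT := X

/-- **IUTchI:Def6.11(iii)** (kurims p.173) **The representative-level groupoid of `Θ^{±ell}`-Hodge theaters** (morphisms `FRepIso`,
constituentwise composition; every morphism invertible) — the `StripFrame.HT`-shape of [IUTchIII] §1 at the `Θ^{±ell}` level.
([IUTchI] Def 6.11 (iii) p.173) [claim: Mochizuki2012, status: disputed] -/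
instance groupoid : Groupoid.{u} (HTRep FK) where
  Hom X Y := FRepIso X.out Y.out
  id X := FRepIso.refl X.out
  comp f g := f.trans g
  id_comp f := FRepIso.refl_trans f
  comp_id f := FRepIso.trans_refl f
  assoc f g h := FRepIso.trans_assoc f g h
  inv f := f.symm
  inv_comp f := FRepIso.symm_trans f
  comp_inv f := FRepIso.trans_symm f

/-- **IUTchI:Def6.11(iii)** (kurims p.173) "the associated `𝒟-Θ^{±ell}`-Hodge theater", functorially in representatives
(the `StripFrame.htToD` shape at the `Θ^{±ell}` level). ([IUTchI] Def 6.11 (iii) p.173) [claim: Mochizuki2012, status: disputed] -/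
def toDFunctor : HTRep FK ⥤ DHTRep K where
  obj X := DHTRep.of X.out.dHT
  map f := f.toD
  map_id _ := rfl
  map_comp _ _ := rfl

/-- **IUTchIII:Prop1.3(i)** (kurims p.42) `†ℋ𝒯^{Θ±ell} ↦ †𝔉_≻` ("one of the `ℱ`-prime-strips that appear in the Θ- and Θ^±-bridges"),
functorially in representatives, into abc-iut-L6-t7's groupoid of `ℱ`-prime-strips — the `StripFrame.strip ≻` shape.
([IUTchIII] Prop 1.3 (i) p.42) [claim: Mochizuki2012, status: disputed] -/
def codFunctor : HTRep FK ⥤ FK.FStrip where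
  obj X := X.out.codomain
  map f := f.cod
  map_id _ := rfl
  map_comp _ _ := rfl

/-- **IUTchIII:Prop1.3(i)** (kurims p.42) `𝒟(†𝔉_≻) = †𝔇_≻` compatibly with `†ℋ𝒯 ↦ †ℋ𝒯^𝒟`: the square
`HTRep ⟶ FStrip ⟶ DStrip` = `HTRep ⟶ DHTRep ⟶ DStrip` commutes up to the identity natural isomorphism, the naturality
being exactly the lifting equation `cod_lifts` — the `StripFrame.strip_comm` shape. ([IUTchIII] Prop 1.3 (i) p.42) [claim: Mochizuki2012, status: disputed] -/
noncomputable def stripComm :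
    codFunctor (FK := FK) ⋙ PrimeStripGroupoids.assocDFunctor FK ≅ toDFunctor ⋙ DHTRep.codFunctor :=
  NatIso.ofComponents (fun _ => Iso.refl _) (fun f => by
    change (PrimeStripGroupoids.assocDFunctor FK).map (codFunctor.map f) ≫ 𝟙 _ =
      𝟙 _ ≫ DHTRep.codFunctor.map (toDFunctor.map f)
    rw [Category.comp_id, Category.id_comp]
    exact f.cod_lifts)

/-- **IUTchI:Cor6.12(i)** (kurims p.173) Under Cor 5.3 (ii), `toDFunctor` is FULL (every `𝒟`-level representative lifts) …
([IUTchI] Cor 6.12 (i) p.173) [claim: Mochizuki2012, status: disputed] -/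
theorem toDFunctor_map_surjective (h : FK.IsomFtoDBijective) (X Y : HTRep FK) :
    Function.Surjective (toDFunctor.map : (X ⟶ Y) → (toDFunctor.obj X ⟶ toDFunctor.obj Y)) :=
  (FRepIso.toD_bijective h).surjective

/-- **IUTchI:Cor6.12(i)** (kurims p.173) … and FAITHFUL. ([IUTchI] Cor 6.12 (i) p.173) [claim: Mochizuki2012, status: disputed] -/
theorem toDFunctor_map_injective (h : FK.IsomFtoDBijective) (X Y : HTRep FK) :
    Function.Injective (toDFunctor.map : (X ⟶ Y) → (toDFunctor.obj X ⟶ toDFunctor.obj Y)) :=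
  (FRepIso.toD_bijective h).injective

/-- **IUTchI:Def6.11(iii)** (kurims p.173) Under Cor 5.3 (ii), any two `Θ^{±ell}`-Hodge theaters are isomorphic in `HTRep FK` (lift
a `𝒟`-level representative, `DHTRep.DRepIso.iso_nonempty`) — the `StripFrame` connectedness shape at this level.
([IUTchI] Def 6.11 (iii) p.173) [claim: Mochizuki2012, status: disputed] -/
theorem iso_nonempty (h : FK.IsomFtoDBijective) (X Y : HTRep FK) : Nonempty (X ≅ Y) := by
  obtain ⟨d⟩ := DHTRep.DRepIso.iso_nonempty X.out.dHT Y.out.dHT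
  exact ⟨(Groupoid.isoEquivHom X Y).symm (FRepIso.ofD h d)⟩

end HTRep

end Literature.IUT.LogThetaLattice

end
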